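import Literature.Geometry.Symplectic.MoserVectorFour
import HarnessLib

/-!
# The complex structure of a wedge-orthonormal positive pair of `2`-forms on `ℝ⁴`

Topic `Literature/Geometry/Symplectic` (groundwork `--supports`
`Literature.Geometry.Symplectic.relNearSymplecticTaubesTubes_exists`; everything here is PROVED,
no named fact is introduced).

First step of the pointwise linear algebra behind Perutz 2006, Lemma 2.1 (b) ("positive-definite
three-plane sub-bundles `Λ⁺ ⊂ Λ²` having `ω` as section" ↔ conformal structures; Donaldson–
Kronheimer §1.1.7: a maximal positive subspace of `(Λ²ℝ⁴, ∧)` is `Λ⁺` of a conformal class),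
needed to adapt charts to a STRICTLY near-symplectic form along its zero set (the definite
gradient image of `NearSymplecticDefinite.lean`):

**two `2`-forms `α, β` on `ℝ⁴` with the same non-zero Pfaffian and vanishing wedge pairing
`α ∧ β = 0` determine a complex structure `K = α⁻¹ ∘ β` (`K² = −1`) with `α(Kv, w) = β(v, w)`,
`β(Kv, w) = −α(v, w)`** — the complex structure for which `α + iβ` has type `(2, 0)`.

The proof is coordinate-free Pfaffian-adjugate algebra on top of the tree's `pfaffAdjCol`
(`OrigamiNullFoliation.lean`: the columns `adj_k(α)` with `α(adj_k(α), w) = −Pf(α) w_k`, i.e.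
`A^∨ A = −Pf(A)·1`):

* `pfaffianPair α β = Pf(α + β) − Pf(α) − Pf(β)` — the polarisation of the Pfaffian, i.e. the
  wedge pairing `(α ∧ β)/e⁰¹²³` (`pfaffianPair_eq`);
* `pfaffAdjCol_add` and the **polarised adjugate identity**
  `α(adj_k(β), w) + β(adj_k(α), w) = −(α ∧ β) w_k` (`alt_two_pfaffAdjCol_polar`);
* `pairMap α β v = Σ_k β(v, e_k) adj_k(α)` (so that `α(pairMap v, w) = −Pf(α) β(v, w)`,
  `alt_two_pairMap`) and the quadratic identity
  `pairMap (pairMap v) = −Pf(α)Pf(β) v − (α ∧ β) · pairMap v` (`pairMap_pairMap`; in matrix form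
  `(A^∨B)² = −Pf(A)Pf(B)·1 − (A ∧ B)·A^∨B`);
* `pairComplex α β = −Pf(α)⁻¹ · pairMap α β`, with `pairComplex_pairComplex`: `K² = −1` when
  `Pf(β) = Pf(α) ≠ 0` and `α ∧ β = 0`; `exists_complexStructure_of_pfaffianPair_eq_zero`.

## References

* T. Perutz, *Zero-sets of near-symplectic forms*, J. Symplectic Geom. 4 (2006), Lemma 2.1 (b)
  [Perutz2006].
* D. McDuff, D. Salamon, *Introduction to Symplectic Topology*, 3rd ed. (2017), §2.1, §3.2
  (linear symplectic algebra, Pfaffian adjugate) [McDuffSalamon2017].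
-/

noncomputable section

open Set Function

namespace Literature.Geometry.Symplectic

/-- Local notation for the model space `ℝ⁴ = EuclideanSpace ℝ (Fin 4)`. -/
local notation "E4" => EuclideanSpace ℝ (Fin 4)

variable (α β : E4 [⋀^Fin 2]→L[ℝ] ℝ)

/-! ### The wedge pairing as the polarised Pfaffian -/

/-- **The wedge pairing of two `2`-forms on `ℝ⁴`** as the polarisation of the Pfaffian:
`⟨α, β⟩ = Pf(α + β) − Pf(α) − Pf(β)`, so that `α ∧ β = ⟨α, β⟩ e⁰ ∧ e¹ ∧ e² ∧ e³`
(`α ∧ α = 2 Pf(α) e⁰¹²³`). [folklore] -/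
def pfaffianPair : ℝ :=
  pfaffian (α + β) - pfaffian α - pfaffian β

/-- Six-term formula for the wedge pairing. [folklore] -/
theorem pfaffianPair_eq :
    pfaffianPair α β =
      α ![stdVec 0, stdVec 1] * β ![stdVec 2, stdVec 3] + β ![stdVec 0, stdVec 1] * α ![stdVec 2, stdVec 3]
      - α ![stdVec 0, stdVec 2] * β ![stdVec 1, stdVec 3] - β ![stdVec 0, stdVec 2] * α ![stdVec 1, stdVec 3]
      + α ![stdVec 0, stdVec 3] * β ![stdVec 1, stdVec 2] + β ![stdVec 0, stdVec 3] * α ![stdVec 1, stdVec 2] := by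
  simp only [pfaffianPair, pfaffian, ContinuousAlternatingMap.add_apply]
  ring

/-- The wedge pairing is symmetric. [folklore] -/
theorem pfaffianPair_comm : pfaffianPair α β = pfaffianPair β α := by
  rw [pfaffianPair_eq, pfaffianPair_eq]; ring

/-- `⟨α, α⟩ = 2 Pf(α)`. [folklore] -/
theorem pfaffianPair_self : pfaffianPair α α = 2 * pfaffian α := by
  rw [pfaffianPair_eq, pfaffian]; ring

/-! ### The polarised adjugate identity -/

/-- The adjugate columns are additive in the form. [folklore] -/
theorem pfaffAdjCol_add (k : Fin 4) : pfaffAdjCol (α + β) k = pfaffAdjCol α k + pfaffAdjCol β k := by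
  fin_cases k <;>
  · ext i
    fin_cases i <;> simp [pfaffAdjCol] <;> ring

/-- **Polarised adjugate identity**: `α(adj_k(β), w) + β(adj_k(α), w) = −⟨α, β⟩ w_k`
(polarise `A^∨ A = −Pf(A)·1` in `A`). [folklore] -/
theorem alt_two_pfaffAdjCol_polar (k : Fin 4) (w : E4) :
    α ![pfaffAdjCol β k, w] + β ![pfaffAdjCol α k, w] = -pfaffianPair α β * w k := by
  have h := alt_two_pfaffAdjCol (α + β) k w
  rw [pfaffAdjCol_add, ContinuousAlternatingMap.add_apply, alt_two_add_left, alt_two_add_left,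
    alt_two_pfaffAdjCol, alt_two_pfaffAdjCol] at h
  rw [pfaffianPair]
  linarith

/-! ### Linear-algebra helpers -/

/-- Expansion in the second argument: `β(v, w) = Σ_k β(v, e_k) w_k`. [folklore] -/
theorem alt_two_sum_right (v w : E4) : β ![v, w] = ∑ k, β ![v, stdVec k] * w k := by
  rw [alt_two_swap, alt_two_sum_left, ← Finset.sum_neg_distrib]
  refine Finset.sum_congr rfl fun k _ => ?_
  rw [alt_two_swap β v (stdVec k)]
  ring

/-- Linearity in the first argument against a finite combination. [folklore] -/
theorem alt_two_sum_smul_left (c : Fin 4 → ℝ) (x : Fin 4 → E4) (w : E4) :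
    β ![∑ k, c k • x k, w] = ∑ k, c k * β ![x k, w] := by
  have hlin : ∀ s : Finset (Fin 4),
      β ![∑ k ∈ s, c k • x k, w] = ∑ k ∈ s, c k * β ![x k, w] := by
    intro s
    induction s using Finset.induction_on with
    | empty =>
      simp only [Finset.sum_empty]
      exact β.map_coord_zero 0 rfl
    | insert a s ha ih =>
      rw [Finset.sum_insert ha, Finset.sum_insert ha, alt_two_add_left, alt_two_smul_left, ih]
  exact hlin Finset.univ

/-- **A non-degenerate `2`-form separates vectors**: if `Pf(α) ≠ 0` and `α(x, w) = α(y, w)` for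
all `w` then `x = y`. [folklore] -/
theorem eq_of_forall_alt_two_eq (hα : pfaffian α ≠ 0) {x y : E4}
    (h : ∀ w, α ![x, w] = α ![y, w]) : x = y := by
  by_contra hxy
  have hne : x - y ≠ 0 := sub_ne_zero.2 hxy
  refine hα ((pfaffian_eq_zero_iff α).2 ⟨x - y, hne, fun w => ?_⟩)
  rw [sub_eq_add_neg, alt_two_add_left, show -y = (-1 : ℝ) • y by simp, alt_two_smul_left, h w]
  ring

/-! ### The pair map `A^∨ B` -/

/-- **The pair map** `pairMap α β v = Σ_k β(v, e_k) adj_k(α)` (`= A^∨ B v` in matrix terms):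
the vector with `α(pairMap v, w) = −Pf(α) β(v, w)`. [folklore] -/
def pairMap (v : E4) : E4 :=
  ∑ k, β ![v, stdVec k] • pfaffAdjCol α k

/-- **`α(pairMap v, w) = −Pf(α) β(v, w)`.** [folklore] -/
theorem alt_two_pairMap (v w : E4) : α ![pairMap α β v, w] = -pfaffian α * β ![v, w] := by
  rw [pairMap, alt_two_sum_smul_pfaffAdjCol, ← alt_two_sum_right]

/-- The pair map is additive. [folklore] -/
theorem pairMap_add (v v' : E4) : pairMap α β (v + v') = pairMap α β v + pairMap α β v' := by
  simp only [pairMap, alt_two_add_left, add_smul, Finset.sum_add_distrib]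

/-- The pair map is homogeneous. [folklore] -/
theorem pairMap_smul (c : ℝ) (v : E4) : pairMap α β (c • v) = c • pairMap α β v := by
  simp only [pairMap, alt_two_smul_left, Finset.smul_sum, smul_smul]

/-- `pairMap α α = −Pf(α) · id` (`A^∨ A = −Pf(A)·1`), for non-degenerate `α`. [folklore] -/
theorem pairMap_self (hα : pfaffian α ≠ 0) (v : E4) : pairMap α α v = -pfaffian α • v := by
  refine eq_of_forall_alt_two_eq α hα fun w => ?_
  rw [alt_two_pairMap, alt_two_smul_left]

/-- **`β(pairMap α β v, w) = −⟨α, β⟩ β(v, w) + Pf(β) α(v, w)`** (polarised adjugate identity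
summed against `β(v, e_k)`), for non-degenerate `β`. [folklore] -/
theorem alt_two_pairMap_right (hβ : pfaffian β ≠ 0) (v w : E4) :
    β ![pairMap α β v, w] = -pfaffianPair α β * β ![v, w] + pfaffian β * α ![v, w] := by
  rw [pairMap, alt_two_sum_smul_left]
  have hk : ∀ k, β ![v, stdVec k] * β ![pfaffAdjCol α k, w] =
      -pfaffianPair α β * (β ![v, stdVec k] * w k) -
        β ![v, stdVec k] * α ![pfaffAdjCol β k, w] := by
    intro k
    have := alt_two_pfaffAdjCol_polar α β k w
    linear_combination (β ![v, stdVec k]) * this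
  simp only [hk, Finset.sum_sub_distrib, ← Finset.mul_sum, ← alt_two_sum_right]
  rw [← alt_two_sum_smul_left, ← pairMap, pairMap_self β hβ, alt_two_smul_left]
  ring

/-- **The quadratic identity of the pair map**:
`pairMap (pairMap v) = −Pf(α)Pf(β) v − ⟨α, β⟩ pairMap v`, i.e. `(A^∨B)² = −Pf(A)Pf(B)·1 − ⟨A, B⟩ A^∨B`
(test against `α(·, w)` and use the two identities above). [folklore] -/
theorem pairMap_pairMap (hα : pfaffian α ≠ 0) (hβ : pfaffian β ≠ 0) (v : E4) :
    pairMap α β (pairMap α β v) =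
      -(pfaffian α * pfaffian β) • v - pfaffianPair α β • pairMap α β v := by
  refine eq_of_forall_alt_two_eq α hα fun w => ?_
  rw [alt_two_pairMap, alt_two_pairMap_right α β hβ, sub_eq_add_neg, alt_two_add_left,
    alt_two_smul_left, show -(pfaffianPair α β • pairMap α β v) =
      (-pfaffianPair α β) • pairMap α β v by rw [neg_smul], alt_two_smul_left, alt_two_pairMap]
  ring

/-! ### The complex structure of a wedge-orthonormal pair -/

/-- **The complex structure of the pair** `K = α⁻¹ ∘ β = −Pf(α)⁻¹ · pairMap α β`: the
endomorphism with `α(Kv, w) = β(v, w)`. [cite: Perutz2006, Lemma 2.1 (b)] -/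
def pairComplex (v : E4) : E4 :=
  -(pfaffian α)⁻¹ • pairMap α β v

/-- **Defining property `α(Kv, w) = β(v, w)`** (for non-degenerate `α`). [cite: Perutz2006, Lemma 2.1 (b)] -/
theorem alt_two_pairComplex (hα : pfaffian α ≠ 0) (v w : E4) :
    α ![pairComplex α β v, w] = β ![v, w] := by
  rw [pairComplex, alt_two_smul_left, alt_two_pairMap]
  field_simp

/-- The complex structure is additive. [folklore] -/
theorem pairComplex_add (v v' : E4) :
    pairComplex α β (v + v') = pairComplex α β v + pairComplex α β v' := by
  simp only [pairComplex, pairMap_add, smul_add]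

/-- The complex structure is homogeneous. [folklore] -/
theorem pairComplex_smul (c : ℝ) (v : E4) : pairComplex α β (c • v) = c • pairComplex α β v := by
  simp only [pairComplex, pairMap_smul, smul_comm c]

/-- **`K² = −1` for a wedge-orthogonal pair with equal non-zero Pfaffians**
(`Pf(β) = Pf(α) ≠ 0`, `⟨α, β⟩ = 0`): the two forms span a definite `2`-plane for the wedge
pairing and `K = α⁻¹β` is a complex structure on `ℝ⁴` (for which `α + iβ` has type `(2,0)`).
[cite: Perutz2006, Lemma 2.1 (b)] -/
theorem pairComplex_pairComplex (hα : pfaffian α ≠ 0) (hβα : pfaffian β = pfaffian α)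
    (horth : pfaffianPair α β = 0) (v : E4) :
    pairComplex α β (pairComplex α β v) = -v := by
  have hβ : pfaffian β ≠ 0 := hβα ▸ hα
  rw [pairComplex, pairComplex, pairMap_smul, pairMap_pairMap α β hα hβ, horth, zero_smul,
    sub_zero, hβα, smul_smul, smul_smul]
  have h : -(pfaffian α)⁻¹ * -(pfaffian α)⁻¹ * -(pfaffian α * pfaffian α) = -1 := by
    field_simp
  rw [h, neg_one_smul]

/-- **`β(Kv, w) = −α(v, w)`**: `K` exchanges the two forms up to sign. [cite: Perutz2006, Lemma 2.1 (b)] -/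
theorem alt_two_pairComplex_right (hα : pfaffian α ≠ 0) (hβα : pfaffian β = pfaffian α)
    (horth : pfaffianPair α β = 0) (v w : E4) :
    β ![pairComplex α β v, w] = -α ![v, w] := by
  rw [← alt_two_pairComplex α β hα (pairComplex α β v) w, pairComplex_pairComplex α β hα hβα horth,
    show -v = (-1 : ℝ) • v by simp, alt_two_smul_left, neg_one_mul]

/-- **`K` is anti-symplectic for `α`**: `α(Kv, Kw) = −α(v, w)` (`α` is the real part of the
`K`-holomorphic symplectic form `α + iβ`). [folklore] -/
theorem alt_two_pairComplex_pairComplex (hα : pfaffian α ≠ 0) (hβα : pfaffian β = pfaffian α)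
    (horth : pfaffianPair α β = 0) (v w : E4) :
    α ![pairComplex α β v, pairComplex α β w] = -α ![v, w] := by
  rw [alt_two_pairComplex α β hα, alt_two_swap, alt_two_pairComplex_right α β hα hβα horth,
    alt_two_swap α w v, neg_neg]

/-- **Existence of the complex structure of a wedge-orthonormal positive pair**, packaged: for
`2`-forms `α, β` on `ℝ⁴` with `Pf(α) = Pf(β) ≠ 0` and `α ∧ β = 0` there is a linear `K` with
`K² = −1`, `α(Kv, w) = β(v, w)` and `β(Kv, w) = −α(v, w)` (Perutz 2006, Lemma 2.1 (b), first
step: a positive-definite plane of `2`-forms determines a complex structure).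
[cite: Perutz2006, Lemma 2.1 (b)] -/
theorem exists_complexStructure_of_pfaffianPair_eq_zero (hα : pfaffian α ≠ 0)
    (hβα : pfaffian β = pfaffian α) (horth : pfaffianPair α β = 0) :
    ∃ K : E4 →ₗ[ℝ] E4, (∀ v, K (K v) = -v) ∧ (∀ v w, α ![K v, w] = β ![v, w]) ∧
      ∀ v w, β ![K v, w] = -α ![v, w] :=
  ⟨{ toFun := pairComplex α β
     map_add' := pairComplex_add α β
     map_smul' := pairComplex_smul α β },
    pairComplex_pairComplex α β hα hβα horth, alt_two_pairComplex α β hα,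
    alt_two_pairComplex_right α β hα hβα horth⟩

end Literature.Geometry.Symplectic

end
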